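import Summits.HodgeConjecture.HodgeConjecture.Theorems.F0P3cStCharTSJacCartanFixedField     -- ★ (C8b-field): `K^σ`, conjugated range lemmas (brings ★ (C8b-frame): `continuous_linearMap_matrix`)
import Summits.HodgeConjecture.HodgeConjecture.Theorems.F0P3cStCharTSCartanDecompositionSkew -- ★ (Q8) F0P3-p04: `exists_cartanLinearPart`, `mem_cartanFixed_iff` (brings `…CartanDecompositionAd`)
import Summits.HodgeConjecture.HodgeConjecture.Theorems.F0P3cStCharTSCayleyChartUnitaryModel -- ★ (C4m): `isClosed_setOf_skew`
import Mathlib.Topology.Algebra.Group.OpenMapping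
import Mathlib.Topology.Algebra.ContinuousMonoidHom
import HarnessLib

/-!
# F0 · P3c · line LH6 «StCharTS» — WIF antecedent, ELLIPTIC half: brick (C8b-data) «MODEL DATA: THE CONJUGATED FRAME AND THE CARTAN PROJECTIONS OF `U(σ,J)(K)`»

Cell `pub/hodgecm-mathlib`, crux H413 = `stmt-HodgeConjecture-24833` (lane `--supports … --as helper`); seat LH5-p02 (g6); ROAD «JAC-ELL» v1 §2 (model inputs of
★ (C8b-socket) `tubeJacobianLocal_of_chartData`).  THEOREMS ONLY; Mathlib + ★ (C8b-field∕frame) + ★ (Q8).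

* `exists_kerProjection` — the `K`-linear projection of `M_N(K) = ker(Ad t − 1) ⊕ range(Ad t − 1)` onto the kernel (★ `…CartanDecompositionAd`), fixing
  the commutant of `t` and killing every `t Y t⁻¹ − Y`;
* `exists_conjFrame` — the CONJUGATED frame `ι = Q(·)Q⁻¹ ∘ subtype : 𝔲 →+ M_N(K)`, `ρ = Q(·)Q⁻¹ ∘ subtype : U(σ,J) →* GL_N(K)`: closed embedding, inducing,
  injective, with ★ (C4u)'s range descriptions for the conjugated form `J′ = σ(Q⁻¹)ᵀ J Q⁻¹`;
* `exists_cartanData` — at a regular unitary `t`: complementary continuous additive projections `pM + pT = id` of `𝔲 = 𝔪 ⊕ 𝔱` (★ Q8 `isCompl`, continuity through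
  `exists_kerProjection`), and the linear part `L = (Ad t⁻¹ − 1)|_𝔪 ⊕ id|_𝔱` as a HOMEOMORPHIC additive automorphism of `𝔲` (★ Q8 `exists_cartanLinearPart` over
  `K^σ`; continuity through its `K`-linear extension, openness by the open mapping theorem), `K^σ`-linear.

HONEST LABEL: count-neutral helper algebra ∕ topology; closes no organ; HC_CM is proved only modulo the printed citations (h413 = `stmt-HodgeConjecture-24833`) until rung 0 closes.

## References
* [PlatonovRapinchuk1994] V. Platonov, A. Rapinchuk, *Algebraic Groups and Number Theory* (1994), §3.3. Context locator.
* [HarishChandra1970] Harish-Chandra (notes by G. van Dijk), *Harmonic Analysis on Reductive p-adic Groups*, LNM 162 (1970), Lemma 22. Context locator.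
-/

set_option autoImplicit false
set_option linter.dupNamespace false

open Set Filter TopologicalSpace Topology Matrix
open Literature.NumberTheory.Automorphic Literature.NumberTheory.Automorphic.UnitaryGroup
open Summit.HodgeConjecture.HodgeConjecture.Cruxes.H413.F0P3cStCharTSCayleyChartUnitaryModel
open Summit.HodgeConjecture.HodgeConjecture.Cruxes.H413.F0P3cStCharTSJacCartanModelFrame
open Summit.HodgeConjecture.HodgeConjecture.Cruxes.H413.F0P3cStCharTSJacCartanFixedField
open Summit.HodgeConjecture.HodgeConjecture.Cruxes.H413.F0P3cStCharTSCartanDecompositionAd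
open Summit.HodgeConjecture.HodgeConjecture.Cruxes.H413.F0P3cStCharTSCartanDecompositionSkew
open scoped Pointwise Topology MatrixGroups

namespace Summit.HodgeConjecture.HodgeConjecture.Cruxes.H413.F0P3cStCharTSJacCartanModelData

variable {K : Type*} [Field K] {N : ℕ} (σ : K →+* K) (J : Matrix (Fin N) (Fin N) K)

/-! ## §1 The `K`-linear projection onto the commutant of a regular element -/

/-- **The projection of `M_N(K) = ker(Ad t − 1) ⊕ range(Ad t − 1)` onto the kernel** (★ `…CartanDecompositionAd.isCompl_ker_range_adSubOne`), as a `K`-linear map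
fixing the commutant of `t` and killing `t Y t⁻¹ − Y`. [cite: PlatonovRapinchuk1994, §3.3] -/
theorem exists_kerProjection [PerfectField K] (t : GL (Fin N) K) (hsep : (t : Matrix (Fin N) (Fin N) K).charpoly.Separable) :
    ∃ P : Matrix (Fin N) (Fin N) K →ₗ[K] Matrix (Fin N) (Fin N) K,
      (∀ X : Matrix (Fin N) (Fin N) K, X * (t : Matrix (Fin N) (Fin N) K) = (t : Matrix (Fin N) (Fin N) K) * X → P X = X) ∧
      (∀ Y : Matrix (Fin N) (Fin N) K, P ((t : Matrix (Fin N) (Fin N) K) * Y * ((t⁻¹ : GL (Fin N) K) : Matrix (Fin N) (Fin N) K) - Y) = 0) := by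
  have hcK := isCompl_ker_range_adSubOne t hsep
  refine ⟨(Submodule.subtype _) ∘ₗ Submodule.projectionOnto _ _ hcK, fun X hX => ?_, fun Y => ?_⟩
  · have hX' : X ∈ LinearMap.ker (LinearMap.mulLeftRight K ((t : Matrix (Fin N) (Fin N) K), ((t⁻¹ : GL (Fin N) K) : Matrix (Fin N) (Fin N) K)) - LinearMap.id) :=
      (mem_ker_adSubOne_iff t X).2 hX
    rw [LinearMap.comp_apply, Submodule.subtype_apply]
    have : X = ((⟨X, hX'⟩ : ↥(LinearMap.ker (LinearMap.mulLeftRight K ((t : Matrix (Fin N) (Fin N) K), ((t⁻¹ : GL (Fin N) K) : Matrix (Fin N) (Fin N) K)) - LinearMap.id))) :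
        Matrix (Fin N) (Fin N) K) := rfl
    rw [this, Submodule.projectionOnto_apply_left]
  · have hY : (t : Matrix (Fin N) (Fin N) K) * Y * ((t⁻¹ : GL (Fin N) K) : Matrix (Fin N) (Fin N) K) - Y ∈
        LinearMap.range (LinearMap.mulLeftRight K ((t : Matrix (Fin N) (Fin N) K), ((t⁻¹ : GL (Fin N) K) : Matrix (Fin N) (Fin N) K)) - LinearMap.id) :=
      ⟨Y, by rw [LinearMap.sub_apply, LinearMap.mulLeftRight_apply, LinearMap.id_apply]⟩
    rw [LinearMap.comp_apply, Submodule.subtype_apply, Submodule.projectionOnto_apply_of_mem_right hcK hY]; rfl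

/-! ## §2 The conjugated frame -/

/-- **THE CONJUGATED CAYLEY FRAME**: `ι Z = Q Z Q⁻¹` on `𝔲(σ,J)` and `ρ u = Q u Q⁻¹` on `U(σ,J)` form ★ (C4u)'s data (closed embedding ∕ inducing ∕ injective,
with the range descriptions for `J′ = σ(Q⁻¹)ᵀ J Q⁻¹`). [cite: PlatonovRapinchuk1994, §3.3] -/
theorem exists_conjFrame [TopologicalSpace K] [IsTopologicalRing K] [T2Space K] (hσ : Continuous σ) (Q : GL (Fin N) K)
    {F : Subfield K} (𝔲 : Submodule ↥F (Matrix (Fin N) (Fin N) K)) (h𝔲 : ∀ X, X ∈ 𝔲 ↔ (X.map σ)ᵀ * J + J * X = 0) :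
    ∃ (ι : ↥𝔲 →+ Matrix (Fin N) (Fin N) K) (ρ : ↥(unitaryGroupOfForm σ J) →* GL (Fin N) K),
      (∀ Z : ↥𝔲, ι Z = (Q : Matrix (Fin N) (Fin N) K) * Z.1 * ((Q⁻¹ : GL (Fin N) K) : Matrix (Fin N) (Fin N) K)) ∧
      (∀ g : ↥(unitaryGroupOfForm σ J), ρ g = Q * g.1 * Q⁻¹) ∧
      IsClosedEmbedding ι ∧ IsInducing ρ ∧ Function.Injective ρ ∧
      (∀ X, X ∈ Set.range ι ↔ ((X.map σ)ᵀ * ((((Q⁻¹ : GL (Fin N) K) : Matrix (Fin N) (Fin N) K).map σ)ᵀ * J * ((Q⁻¹ : GL (Fin N) K) : Matrix (Fin N) (Fin N) K)) +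
        ((((Q⁻¹ : GL (Fin N) K) : Matrix (Fin N) (Fin N) K).map σ)ᵀ * J * ((Q⁻¹ : GL (Fin N) K) : Matrix (Fin N) (Fin N) K)) * X = 0 ∧ X * 1 = 1 * X)) ∧
      (∀ g : GL (Fin N) K, g ∈ Set.range ρ ↔
        ((((g : Matrix (Fin N) (Fin N) K)).map σ)ᵀ * ((((Q⁻¹ : GL (Fin N) K) : Matrix (Fin N) (Fin N) K).map σ)ᵀ * J * ((Q⁻¹ : GL (Fin N) K) : Matrix (Fin N) (Fin N) K)) *
            (g : Matrix (Fin N) (Fin N) K) = (((Q⁻¹ : GL (Fin N) K) : Matrix (Fin N) (Fin N) K).map σ)ᵀ * J * ((Q⁻¹ : GL (Fin N) K) : Matrix (Fin N) (Fin N) K) ∧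
          (g : Matrix (Fin N) (Fin N) K) * 1 = 1 * (g : Matrix (Fin N) (Fin N) K))) := by
  set Qm : Matrix (Fin N) (Fin N) K := (Q : Matrix (Fin N) (Fin N) K) with hQmdef
  set Qi : Matrix (Fin N) (Fin N) K := ((Q⁻¹ : GL (Fin N) K) : Matrix (Fin N) (Fin N) K) with hQidef
  have hQQ : Qi * Qm = 1 := by rw [hQidef, hQmdef, ← Units.val_mul, inv_mul_cancel, Units.val_one]
  have hQQ' : Qm * Qi = 1 := by rw [hQidef, hQmdef, ← Units.val_mul, mul_inv_cancel, Units.val_one]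
  have h𝔲cl : IsClosed (𝔲 : Set (Matrix (Fin N) (Fin N) K)) := by
    have : (𝔲 : Set (Matrix (Fin N) (Fin N) K)) = {X | (X.map σ)ᵀ * J + J * X = 0} := Set.ext fun X => h𝔲 X
    rw [this]; exact isClosed_setOf_skew σ J hσ
  let ι : ↥𝔲 →+ Matrix (Fin N) (Fin N) K :=
    { toFun := fun Z => Qm * Z.1 * Qi
      map_zero' := by simp
      map_add' := fun a b => by simp only [Submodule.coe_add, mul_add, add_mul] }
  let ρ : ↥(unitaryGroupOfForm σ J) →* GL (Fin N) K := (MulAut.conj Q).toMonoidHom.comp (unitaryGroupOfForm σ J).subtype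
  let eQ : Matrix (Fin N) (Fin N) K ≃ₜ Matrix (Fin N) (Fin N) K :=
    { toFun := fun X => Qm * X * Qi
      invFun := fun X => Qi * X * Qm
      left_inv := fun X => by
        show Qi * (Qm * X * Qi) * Qm = X
        calc _ = (Qi * Qm) * X * (Qi * Qm) := by noncomm_ring
          _ = X := by rw [hQQ, one_mul, mul_one]
      right_inv := fun X => by
        show Qm * (Qi * X * Qm) * Qi = X
        calc _ = (Qm * Qi) * X * (Qm * Qi) := by noncomm_ring
          _ = X := by rw [hQQ', one_mul, mul_one]
      continuous_toFun := (continuous_const.mul continuous_id).mul continuous_const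
      continuous_invFun := (continuous_const.mul continuous_id).mul continuous_const }
  refine ⟨ι, ρ, fun Z => rfl, fun g => rfl, ?_, ?_, (MulAut.conj Q).injective.comp Subtype.val_injective,
    fun X => range_conj_skew_iff σ J Q h𝔲 X, fun g => range_conj_unitary_iff σ J Q g⟩
  · have : (ι : ↥𝔲 → Matrix (Fin N) (Fin N) K) = eQ ∘ Subtype.val := rfl
    rw [this]; exact eQ.isClosedEmbedding.comp h𝔲cl.isClosedEmbedding_subtypeVal
  · have : (ρ : ↥(unitaryGroupOfForm σ J) → GL (Fin N) K) = ((Homeomorph.mulLeft Q).trans (Homeomorph.mulRight Q⁻¹)) ∘ Subtype.val := rfl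
    rw [this]; exact (Homeomorph.isInducing _).comp IsInducing.subtypeVal

/-! ## §3 The Cartan projections and the linear part -/

/-- **THE CARTAN DATA AT A REGULAR UNITARY `t`** (★ Q8 over `K^σ`): continuous complementary additive projections `pM + pT = id` (`pM` idempotent, `pT` onto the
commutant of `t`, the commutant inside `ker pM`), the linear part `L` (`= id` on the commutant, `= Ad t⁻¹ − 1` on `t Y t⁻¹ − Y`, and `L = L∘pT + L∘pM` in matrix
form) as a homeomorphic additive automorphism, all `K^σ`-linear. [cite: HarishChandra1970, Lemma 22] [cite: PlatonovRapinchuk1994, §3.3] -/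
theorem exists_cartanData [PerfectField K] [TopologicalSpace K] [IsTopologicalRing K] {F : Subfield K} [FiniteDimensional ↥F K]
    (𝔲 : Submodule ↥F (Matrix (Fin N) (Fin N) K)) (h𝔲 : ∀ X, X ∈ 𝔲 ↔ (X.map σ)ᵀ * J + J * X = 0) (hJ : IsUnit J.det)
    [T2Space ↥𝔲] [LocallyCompactSpace ↥𝔲] [SecondCountableTopology ↥𝔲]
    (t : GL (Fin N) K) (htU : ((t : Matrix (Fin N) (Fin N) K).map σ)ᵀ * J * (t : Matrix (Fin N) (Fin N) K) = J) (hsep : (t : Matrix (Fin N) (Fin N) K).charpoly.Separable) :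
    ∃ (pM pT : ↥𝔲 →+ ↥𝔲) (L : ↥𝔲 ≃ₜ+ ↥𝔲),
      (∀ Z, pM Z + pT Z = Z) ∧ (∀ Z, pM (pM Z) = pM Z) ∧ Continuous pM ∧ Continuous pT ∧
      (∀ Z, (pT Z).1 * (t : Matrix (Fin N) (Fin N) K) = (t : Matrix (Fin N) (Fin N) K) * (pT Z).1) ∧
      (∀ X : ↥𝔲, X.1 * (t : Matrix (Fin N) (Fin N) K) = (t : Matrix (Fin N) (Fin N) K) * X.1 → pM X = 0) ∧
      (∀ Z, (L Z).1 = ((t⁻¹ : GL (Fin N) K) : Matrix (Fin N) (Fin N) K) * (pM Z).1 * (t : Matrix (Fin N) (Fin N) K) - (pM Z).1 + (pT Z).1) ∧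
      (∀ X : ↥𝔲, X.1 * (t : Matrix (Fin N) (Fin N) K) = (t : Matrix (Fin N) (Fin N) K) * X.1 → L X = X) ∧
      (∀ (X : ↥𝔲) (Y : Matrix (Fin N) (Fin N) K), X.1 = (t : Matrix (Fin N) (Fin N) K) * Y * ((t⁻¹ : GL (Fin N) K) : Matrix (Fin N) (Fin N) K) - Y →
        (L X).1 = ((t⁻¹ : GL (Fin N) K) : Matrix (Fin N) (Fin N) K) * X.1 * (t : Matrix (Fin N) (Fin N) K) - X.1) ∧
      (∀ (a : ↥F) (Z : ↥𝔲), pM (a • Z) = a • pM Z) ∧ (∀ (a : ↥F) (Z : ↥𝔲), pT (a • Z) = a • pT Z) ∧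
      (∀ (a : ↥F) (Z : ↥𝔲), L.symm (a • Z) = a • L.symm Z) := by
  set tGm : Matrix (Fin N) (Fin N) K := (t : Matrix (Fin N) (Fin N) K) with htGmdef
  set tGi : Matrix (Fin N) (Fin N) K := ((t⁻¹ : GL (Fin N) K) : Matrix (Fin N) (Fin N) K) with htGidef
  -- ★ (Q8), packaged with matrix-level membership descriptions
  obtain ⟨𝔱, 𝔪, hc𝔱𝔪, Lq, ΦK, hmem𝔱, hmem𝔪, hL𝔱, hL𝔪, hΦL⟩ : ∃ (𝔱 𝔪 : Submodule ↥F ↥𝔲) (_ : IsCompl 𝔱 𝔪) (Lq : ↥𝔲 ≃ₗ[↥F] ↥𝔲)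
      (ΦK : Matrix (Fin N) (Fin N) K →ₗ[K] Matrix (Fin N) (Fin N) K),
      (∀ X : ↥𝔲, X ∈ 𝔱 ↔ X.1 * tGm = tGm * X.1) ∧ (∀ X : ↥𝔲, X ∈ 𝔪 ↔ ∃ Y : Matrix (Fin N) (Fin N) K, tGm * Y * tGi - Y = X.1) ∧
      (∀ X : ↥𝔲, X ∈ 𝔱 → Lq X = X) ∧ (∀ X : ↥𝔲, X ∈ 𝔪 → (Lq X).1 = tGi * X.1 * tGm - X.1) ∧ (∀ X : ↥𝔲, ΦK X.1 = (Lq X).1) := by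
    obtain ⟨hc, Lq, ΦK, h1, h2, -, h4, -, -⟩ := exists_cartanLinearPart σ J hJ 𝔲 h𝔲 t htU hsep
    refine ⟨_, _, hc, Lq, ΦK, fun X => mem_cartanFixed_iff 𝔲 t X, fun X => ?_, h1, h2, h4⟩
    rw [Submodule.mem_comap, Submodule.restrictScalars_mem, LinearMap.mem_range]
    exact Iff.rfl
  have hdec : ∀ Z : ↥𝔲, ∃ a ∈ 𝔱, ∃ b ∈ 𝔪, a + b = Z := fun Z =>
    Submodule.mem_sup.1 (by rw [hc𝔱𝔪.sup_eq_top]; exact Submodule.mem_top)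
  obtain ⟨PT, hPTdef⟩ : ∃ PT : ↥𝔲 →ₗ[↥F] ↥𝔲, ∀ Z, PT Z = ((Submodule.projectionOnto 𝔱 𝔪 hc𝔱𝔪 Z : ↥𝔱) : ↥𝔲) :=
    ⟨𝔱.subtype ∘ₗ Submodule.projectionOnto 𝔱 𝔪 hc𝔱𝔪, fun Z => rfl⟩
  have hPTfix : ∀ Z : ↥𝔲, Z ∈ 𝔱 → PT Z = Z := fun Z hZ => by
    rw [hPTdef]
    have : Z = ((⟨Z, hZ⟩ : ↥𝔱) : ↥𝔲) := rfl
    rw [this, Submodule.projectionOnto_apply_left]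
  have hPT0 : ∀ Z : ↥𝔲, Z ∈ 𝔪 → PT Z = 0 := fun Z hZ => by
    rw [hPTdef, Submodule.projectionOnto_apply_of_mem_right hc𝔱𝔪 hZ]; rfl
  have hPT𝔱 : ∀ Z : ↥𝔲, PT Z ∈ 𝔱 := fun Z => by rw [hPTdef]; exact (Submodule.projectionOnto 𝔱 𝔪 hc𝔱𝔪 Z).2
  have hPM𝔪 : ∀ Z : ↥𝔲, Z - PT Z ∈ 𝔪 := fun Z => by
    obtain ⟨a, ha, b, hb, hab⟩ := hdec Z
    rw [← hab, map_add, hPTfix a ha, hPT0 b hb, add_zero, add_sub_cancel_left]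
    exact hb
  -- continuity of `PT`: restriction of the `K`-linear projection
  obtain ⟨PK, hPKfix, hPK0⟩ := exists_kerProjection t hsep
  have hPTK : ∀ Z : ↥𝔲, (PT Z).1 = PK Z.1 := fun Z => by
    obtain ⟨a, ha, b, hb, hab⟩ := hdec Z
    obtain ⟨Y, hY⟩ := (hmem𝔪 b).1 hb
    rw [← hab, map_add, hPTfix a ha, hPT0 b hb, add_zero, Submodule.coe_add, map_add, hPKfix _ ((hmem𝔱 a).1 ha), ← hY, hPK0 Y, add_zero]
  have hPTc : Continuous PT := by
    refine continuous_induced_rng.2 ?_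
    have : (Subtype.val ∘ PT : ↥𝔲 → Matrix (Fin N) (Fin N) K) = PK ∘ Subtype.val := funext fun Z => hPTK Z
    rw [this]; exact (continuous_linearMap_matrix PK).comp continuous_subtype_val
  -- the linear part: continuous (via `ΦK`), open (open mapping theorem), hence a homeomorphism
  have hLc : Continuous Lq := by
    refine continuous_induced_rng.2 ?_
    have : (Subtype.val ∘ Lq : ↥𝔲 → Matrix (Fin N) (Fin N) K) = ΦK ∘ Subtype.val := funext fun Z => (hΦL Z).symm
    rw [this]; exact (continuous_linearMap_matrix ΦK).comp continuous_subtype_val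
  have hLopen : IsOpenMap Lq := AddMonoidHom.isOpenMap_of_sigmaCompact Lq.toLinearMap.toAddMonoidHom Lq.surjective hLc
  let Lh : ↥𝔲 ≃ₜ ↥𝔲 := Lq.toEquiv.toHomeomorphOfContinuousOpen hLc hLopen
  let L : ↥𝔲 ≃ₜ+ ↥𝔲 := { Lq.toAddEquiv with continuous_toFun := hLc, continuous_invFun := Lh.symm.continuous }
  refine ⟨(LinearMap.id - PT : ↥𝔲 →ₗ[↥F] ↥𝔲).toAddMonoidHom, PT.toAddMonoidHom, L, fun Z => ?_, fun Z => ?_, ?_, hPTc, fun Z => (hmem𝔱 _).1 (hPT𝔱 Z),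
    fun X hX => ?_, fun Z => ?_, fun X hX => hL𝔱 X ((hmem𝔱 X).2 hX), fun X Y hXY => hL𝔪 X ((hmem𝔪 X).2 ⟨Y, hXY.symm⟩),
    fun a Z => ?_, fun a Z => map_smul PT a Z, fun a Z => LinearEquiv.map_smul Lq.symm a Z⟩
  · show Z - PT Z + PT Z = Z
    exact sub_add_cancel Z (PT Z)
  · show Z - PT Z - PT (Z - PT Z) = Z - PT Z
    rw [map_sub, hPTfix _ (hPT𝔱 Z), sub_self, sub_zero]
  · show Continuous fun Z : ↥𝔲 => Z - PT Z
    exact continuous_id.sub hPTc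
  · show X - PT X = 0
    rw [hPTfix X ((hmem𝔱 X).2 hX), sub_self]
  · show (Lq Z).1 = tGi * (Z - PT Z).1 * tGm - (Z - PT Z).1 + (PT Z).1
    have hZ : Lq Z = Lq (PT Z) + Lq (Z - PT Z) := by rw [← map_add, add_sub_cancel]
    rw [hZ, Submodule.coe_add, hL𝔱 _ (hPT𝔱 Z), hL𝔪 _ (hPM𝔪 Z)]
    abel
  · show a • Z - PT (a • Z) = a • (Z - PT Z)
    rw [map_smul, smul_sub]

end Summit.HodgeConjecture.HodgeConjecture.Cruxes.H413.F0P3cStCharTSJacCartanModelData
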